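import Summits.Ventures.PercRepro.SixThreeTable
import Summits.Ventures.PercRepro.SixThreeBridge

/-!
# PercRepro — the seam between p3's additive table and p2's profile bound (p2, gen 6)

p3's `SixThreeTable.lean` (namespace `PercRepro.SixThree.Table`) defines the profile function `F t g l`, the demand
`D t g l`, `N3cnt`, `C2` on `List ℕ` profiles and proves the Step-4 table rows; p2's `SixThreeProfile.lean` /
`SixThreeBridge.lean` define `FsumAdd n g P`, `N3 g P`, `C2gen g P` on `Multiset ℕ` profiles and prove
`FsumAdd ≤ Fsum ≤ Σ_{B ∈ R₃(G)} v(B, n)` on real planes.  This file proves the identities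

    Table.F t g l = FsumAdd (6 − t) g ↑l,   Table.N3cnt g l = N3 g ↑l,   Table.C2 g l = C2gen g ↑l

under the realisability facts of a real plane (every `m ≤ g − 1`, `Σ C(m,s) ≤ C(g,s)`, the lp / `(s−2)`-type counts
below `N_s`), and discharges the table hypotheses of `c025_six_three_of_P1_tables5` from the five `table_*` rows.
-/

namespace PercRepro

namespace SixThree

open Finset

/-! ### Stage 1: the numeric identities -/

/-- `Table.sumIcc f lo n = Σ_{s ∈ Icc lo n} f s`. -/
theorem sumIcc_eq (f : ℕ → ℚ) (lo : ℕ) : ∀ n, Table.sumIcc f lo n = ∑ s ∈ Finset.Icc lo n, f s := by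
  intro n
  induction n with
  | zero =>
    unfold Table.sumIcc
    by_cases h : lo = 0
    · rw [if_pos h, h]; simp
    · rw [if_neg h]
      have : Finset.Icc lo 0 = ∅ := Finset.Icc_eq_empty (by omega)
      rw [this, Finset.sum_empty]
  | succ n ih =>
    unfold Table.sumIcc
    rw [ih]
    by_cases h : lo ≤ n + 1
    · rw [if_pos h]
      have : Finset.Icc lo (n + 1) = insert (n + 1) (Finset.Icc lo n) := by
        ext x; simp only [Finset.mem_Icc, Finset.mem_insert]; omega
      rw [this, Finset.sum_insert (by simp)]
      ring
    · rw [if_neg h]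
      have h1 : Finset.Icc lo (n + 1) = ∅ := Finset.Icc_eq_empty (by omega)
      have h2 : Finset.Icc lo n = ∅ := Finset.Icc_eq_empty (by omega)
      rw [h1, h2]; simp

/-- `Table.ch = Nat.choose` as rationals. -/
theorem ch_cast (n k : ℕ) : ((Table.ch n k : ℕ) : ℚ) = ((n.choose k : ℕ) : ℚ) := by
  rw [Table.ch_eq_choose]

/-- The coefficient identities behind `v_t`: `C(6 − t, 2) − π_t = 2(6 − t) − 3` and `π_t = C(4 − t, 2)` for
`t ∈ {1, 2, 3}`. -/
theorem coeff_eq {t : ℕ} (ht : t = 1 ∨ t = 2 ∨ t = 3) :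
    (((Table.ch (6 - t) 2 - Table.πt t : ℕ) : ℚ)) = 2 * ((6 - t : ℕ) : ℚ) - 3 ∧
    ((Table.πt t : ℕ) : ℚ) = (((6 - t - 2).choose 2 : ℕ) : ℚ) := by
  rcases ht with rfl | rfl | rfl <;> simp [Table.ch, Table.πt, Nat.factorial] <;> norm_num

/-- `Table.v t (w₁ b Λ) (w₂ b Λ) (w₂⁻ b Λ) = vFun (6 − t) b Λ`. -/
theorem v_eq_vFun {t : ℕ} (ht : t = 1 ∨ t = 2 ∨ t = 3) (b : ℕ) (Λ : ℚ) :
    Table.v t (Table.w1 b Λ) (Table.w2 b Λ) (Table.w2m b Λ) = vFun (6 - t) b Λ := by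
  obtain ⟨h1, h2⟩ := coeff_eq ht
  unfold Table.v Table.w1 Table.w2 Table.w2m vFun
  rw [h1, h2]

/-- `Table.vTriple t = vTriExact (6 − t)`. -/
theorem vTriple_eq {t : ℕ} (ht : t = 1 ∨ t = 2 ∨ t = 3) : Table.vTriple t = vTriExact (6 - t) := by
  obtain ⟨h1, h2⟩ := coeff_eq ht
  unfold Table.vTriple Table.v vTriExact
  rw [h1, h2]

/-- `Table.vGen4 t = v4gen (6 − t)`, `Table.vCol4 t = v4col (6 − t)`. -/
theorem vGen4_eq {t : ℕ} (ht : t = 1 ∨ t = 2 ∨ t = 3) : Table.vGen4 t = v4gen (6 - t) := v_eq_vFun ht 4 6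
/-- See `vGen4_eq`. -/
theorem vCol4_eq {t : ℕ} (ht : t = 1 ∨ t = 2 ∨ t = 3) : Table.vCol4 t = v4col (6 - t) := v_eq_vFun ht 4 9

/-- `Table.vLp t s = vlp (6 − t) s` for `s ≥ 1`. -/
theorem vLp_eq {t : ℕ} (ht : t = 1 ∨ t = 2 ∨ t = 3) {s : ℕ} (hs : 1 ≤ s) : Table.vLp t s = vlp (6 - t) s := by
  unfold Table.vLp vlp Llp
  rw [v_eq_vFun ht]
  congr 2
  unfold Table.ΛLp
  rw [Nat.cast_sub hs, Nat.cast_one]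

/-- `Table.vNon t s = vd (6 − t) s`. -/
theorem vNon_eq {t : ℕ} (ht : t = 1 ∨ t = 2 ∨ t = 3) (s : ℕ) : Table.vNon t s = vd (6 - t) s := by
  unfold Table.vNon vd Ld Table.ΛNon
  rw [v_eq_vFun ht]

/-- `Table.vRest t s = vrest (6 − t) s`. -/
theorem vRest_eq {t : ℕ} (ht : t = 1 ∨ t = 2 ∨ t = 3) (s : ℕ) : Table.vRest t s = vrest (6 - t) s := by
  unfold Table.vRest vrest Lrest Table.ΛRest
  rw [v_eq_vFun ht, ch_cast, ch_cast]

/-! ### Stage 2: the counts — casts of the `ℕ`-truncated profile counts to p3's rational ones -/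

/-- A multiset sum over the coercion of a list, cast to `ℚ`. -/
theorem cast_msum (f : ℕ → ℕ) (l : List ℕ) :
    (((Multiset.map f (l : Multiset ℕ)).sum : ℕ) : ℚ) = (l.map fun m => ((f m : ℕ) : ℚ)).sum := by
  rw [Multiset.map_coe, Multiset.sum_coe, Nat.cast_list_sum, List.map_map]
  rfl

/-- `N_s` (no truncation when `Σ C(m, s) ≤ C(g, s)`). -/
theorem Ns_cast {g s : ℕ} {l : List ℕ}
    (h : (Multiset.map (fun m => m.choose s) (l : Multiset ℕ)).sum ≤ g.choose s) :
    ((Ns g (l : Multiset ℕ) s : ℕ) : ℚ) = Table.Ns g l s := by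
  unfold Ns Table.Ns
  rw [Nat.cast_sub h, cast_msum]
  simp only [Table.ch_eq_choose]

/-- `lp_s`. -/
theorem lps_cast (g s : ℕ) (l : List ℕ) : ((lps g (l : Multiset ℕ) s : ℕ) : ℚ) = Table.lps g l s := by
  unfold lps Table.lps
  rw [cast_msum]
  simp only [Table.ch_eq_choose, Nat.cast_mul]

/-- `T = N₃`. -/
theorem Tcnt_cast {g : ℕ} {l : List ℕ}
    (h : (Multiset.map (fun m => m.choose 3) (l : Multiset ℕ)).sum ≤ g.choose 3) :
    ((Ns g (l : Multiset ℕ) 3 : ℕ) : ℚ) = Table.Tcnt g l := by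
  rw [Ns_cast h]; rfl

/-- `N₄^c = lp₄`. -/
theorem N4c_cast (g : ℕ) (l : List ℕ) : ((lps g (l : Multiset ℕ) 4 : ℕ) : ℚ) = Table.N4c g l := by
  rw [lps_cast]
  unfold Table.lps Table.N4c
  congr 1
  apply List.map_congr_left
  intro m _
  ring

/-- `d_s` (`s ≥ 5`; at `s = 5` the truncation `N₅ − lp₅` is exact when `lp₅ ≤ N₅`). -/
theorem dsAdd_cast {g s : ℕ} (hs5 : 5 ≤ s) {l : List ℕ}
    (h5 : lps g (l : Multiset ℕ) 5 ≤ Ns g (l : Multiset ℕ) 5)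
    (hN : (Multiset.map (fun m => m.choose 5) (l : Multiset ℕ)).sum ≤ g.choose 5) :
    ((dsAdd g (l : Multiset ℕ) s : ℕ) : ℚ) = Table.ds g l s := by
  unfold dsAdd Table.ds
  by_cases h6 : 6 ≤ s
  · rw [if_neg (by omega), if_pos h6, cast_msum]
    simp only [Table.ch_eq_choose, Nat.cast_mul]
  · have hs : s = 5 := by omega
    subst hs
    rw [if_pos rfl, if_neg (by omega), Nat.cast_sub h5, Ns_cast hN, lps_cast]

/-- `rest_s` (`s ≥ 5`; exact when `d_s + lp_s ≤ N_s`, the realisability bound for `s ≥ 6`). -/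
theorem restsAdd_cast {g s : ℕ} (hs5 : 5 ≤ s) {l : List ℕ}
    (h5 : lps g (l : Multiset ℕ) 5 ≤ Ns g (l : Multiset ℕ) 5)
    (hN : ∀ s, 3 ≤ s → (Multiset.map (fun m => m.choose s) (l : Multiset ℕ)).sum ≤ g.choose s)
    (h6 : ∀ s, 6 ≤ s → (Multiset.map (fun m => m.choose (s - 2) * (g - m).choose 2) (l : Multiset ℕ)).sum +
      lps g (l : Multiset ℕ) s ≤ Ns g (l : Multiset ℕ) s) :
    ((restsAdd g (l : Multiset ℕ) s : ℕ) : ℚ) = Table.rests g l s := by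
  unfold restsAdd Table.rests
  by_cases hs6 : 6 ≤ s
  · have hle := h6 s hs6
    have hd : dsAdd g (l : Multiset ℕ) s =
        (Multiset.map (fun m => m.choose (s - 2) * (g - m).choose 2) (l : Multiset ℕ)).sum := by
      unfold dsAdd; rw [if_neg (by omega)]
    rw [Nat.cast_sub (by omega), Nat.cast_sub (by omega), dsAdd_cast hs5 h5 (hN 5 (by norm_num)),
      Ns_cast (hN s (by omega)), lps_cast]
  · have hs : s = 5 := by omega
    subst hs
    have hd : dsAdd g (l : Multiset ℕ) 5 = Ns g (l : Multiset ℕ) 5 - lps g (l : Multiset ℕ) 5 := by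
      unfold dsAdd; rw [if_pos rfl]
    rw [hd, Nat.sub_self, Nat.cast_zero]
    unfold Table.ds
    rw [if_neg (by omega)]
    ring

/-- `4 · C(n, 4) = (n − 3) · C(n, 3)`. -/
theorem four_mul_choose_four (n : ℕ) :
    (4 : ℚ) * ((n.choose 4 : ℕ) : ℚ) = ((n - 3 : ℕ) : ℚ) * ((n.choose 3 : ℕ) : ℚ) := by
  have h := Nat.choose_succ_right_eq n 3
  have h' : ((n.choose 4 * 4 : ℕ) : ℚ) = ((n.choose 3 * (n - 3) : ℕ) : ℚ) := by rw [h]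
  push_cast at h'
  linarith

/-- The summed form of `four_mul_choose_four` over a profile with `3 ≤ m ≤ g`:
`4 Σ C(m,4) + 4 Σ (g − m) C(m,3) = (g − 3) Σ C(m,3) + 3 Σ C(m,3) (g − m)`. -/
theorem sum_four_ident {g : ℕ} : ∀ (l : List ℕ), (∀ m ∈ l, 3 ≤ m ∧ m ≤ g) →
    (4 : ℚ) * (l.map fun m => ((m.choose 4 : ℕ) : ℚ)).sum +
      4 * (l.map fun m => ((g - m : ℕ) : ℚ) * ((m.choose 3 : ℕ) : ℚ)).sum =
    ((g - 3 : ℕ) : ℚ) * (l.map fun m => ((m.choose 3 : ℕ) : ℚ)).sum +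
      3 * (l.map fun m => ((m.choose 3 : ℕ) : ℚ) * ((g - m : ℕ) : ℚ)).sum
  | [], _ => by simp
  | m :: l, h => by
    have hm := h m (List.mem_cons_self ..)
    have ih := sum_four_ident l (fun x hx => h x (List.mem_cons_of_mem m hx))
    simp only [List.map_cons, List.sum_cons]
    have h4 := four_mul_choose_four m
    have e1 : ((g - m : ℕ) : ℚ) = (g : ℚ) - m := by rw [Nat.cast_sub hm.2]
    have e2 : ((g - 3 : ℕ) : ℚ) = (g : ℚ) - 3 := by rw [Nat.cast_sub (by omega)]; norm_num
    have e3 : ((m - 3 : ℕ) : ℚ) = (m : ℚ) - 3 := by rw [Nat.cast_sub hm.1]; norm_num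
    rw [e1, e2]
    rw [e2] at ih
    rw [e3] at h4
    linear_combination h4 + ih

/-- `N₄^g = N₄ − lp₄` (exact when `lp₄ ≤ N₄`). -/
theorem N4g_cast {g : ℕ} {l : List ℕ} (hm : ∀ m ∈ l, 3 ≤ m ∧ m ≤ g)
    (hN4 : (Multiset.map (fun m => m.choose 4) (l : Multiset ℕ)).sum ≤ g.choose 4)
    (h4 : lps g (l : Multiset ℕ) 4 ≤ Ns g (l : Multiset ℕ) 4) :
    ((Ns g (l : Multiset ℕ) 4 - lps g (l : Multiset ℕ) 4 : ℕ) : ℚ) = Table.N4g g l := by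
  rw [Nat.cast_sub h4, Ns_cast hN4, lps_cast]
  unfold Table.N4g Table.Tcnt Table.N4c Table.Ns Table.lps
  simp only [Table.ch_eq_choose]
  have hg := four_mul_choose_four g
  have hl := sum_four_ident l hm
  linear_combination (1 / 4 : ℚ) * hg - (1 / 4 : ℚ) * hl

/-- `Σ_{s=3}^{g} C(m, s) = 2^m − 1 − m − C(m, 2)` for `3 ≤ m ≤ g`. -/
theorem sum_Icc_choose {m g : ℕ} (hm3 : 3 ≤ m) (hmg : m ≤ g) :
    (∑ s ∈ Finset.Icc 3 g, ((m.choose s : ℕ) : ℚ)) = 2 ^ m - 1 - m - ((m.choose 2 : ℕ) : ℚ) := by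
  have h1 : (∑ s ∈ Finset.range (g + 1), ((m.choose s : ℕ) : ℚ)) = 2 ^ m := by
    rw [← Finset.sum_range_add_sum_Ico _ (Nat.succ_le_succ hmg)]
    rw [Finset.sum_eq_zero (s := Finset.Ico (m + 1) (g + 1)) (fun s hs => by
      rw [Finset.mem_Ico] at hs
      rw [Nat.choose_eq_zero_of_lt (by omega), Nat.cast_zero]), add_zero]
    exact_mod_cast Nat.sum_range_choose m
  have h2 := Finset.sum_range_add_sum_Ico (fun s => ((m.choose s : ℕ) : ℚ)) (m := 3) (n := g + 1) (by omega)
  rw [h1, Finset.Ico_add_one_right_eq_Icc, Finset.sum_range_succ, Finset.sum_range_succ,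
    Finset.sum_range_succ, Finset.sum_range_zero, Nat.choose_zero_right, Nat.choose_one_right] at h2
  push_cast at h2
  linarith

/-- The double sum `Σ_{s=3}^{g} Σ_{m ∈ l} C(m, s)` over a profile with `3 ≤ m ≤ g`. -/
theorem sum_Icc_list {g : ℕ} : ∀ (l : List ℕ), (∀ m ∈ l, 3 ≤ m ∧ m ≤ g) →
    (∑ s ∈ Finset.Icc 3 g, (l.map fun m => ((m.choose s : ℕ) : ℚ)).sum) =
      (l.map fun m : ℕ => (2 : ℚ) ^ m - 1 - m - ((m.choose 2 : ℕ) : ℚ)).sum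
  | [], _ => by simp
  | m :: l, h => by
    have hm := h m (List.mem_cons_self ..)
    simp only [List.map_cons, List.sum_cons]
    rw [Finset.sum_add_distrib, sum_Icc_choose hm.1 hm.2,
      sum_Icc_list l (fun x hx => h x (List.mem_cons_of_mem m hx))]

/-- `N₃ = Σ_{s=3}^{g} N_s`. -/
theorem N3_cast {g : ℕ} {l : List ℕ} (hm : ∀ m ∈ l, 3 ≤ m ∧ m ≤ g)
    (hN : ∀ s, 3 ≤ s → (Multiset.map (fun m => m.choose s) (l : Multiset ℕ)).sum ≤ g.choose s) :
    ((N3 g (l : Multiset ℕ) : ℕ) : ℚ) = Table.N3cnt g l := by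
  unfold N3 Table.N3cnt
  rw [Nat.cast_sum, sumIcc_eq]
  have hc : ∀ s ∈ Finset.Icc 3 g, ((Ns g (l : Multiset ℕ) s : ℕ) : ℚ) = Table.Ns g l s :=
    fun s hs => Ns_cast (hN s (Finset.mem_Icc.1 hs).1)
  rw [Finset.sum_congr rfl hc]
  unfold Table.Ns
  rw [Finset.sum_sub_distrib]
  simp only [Table.ch_eq_choose]
  rw [sum_Icc_list l hm]

/-- `C₂`. -/
theorem C2gen_cast {g : ℕ} {l : List ℕ}
    (h2 : (Multiset.map (fun m => m.choose 2) (l : Multiset ℕ)).sum ≤ g.choose 2) :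
    ((C2gen g (l : Multiset ℕ) : ℕ) : ℚ) = Table.C2 g l := by
  unfold C2gen Table.C2
  rw [Nat.cast_add, Nat.cast_add, Nat.cast_add, Nat.cast_sub h2, cast_msum, cast_msum]
  simp only [Table.ch_eq_choose, Nat.cast_one]
  have e : ∀ m : ℕ, (((2 ^ m - 1 - m : ℕ)) : ℚ) = (2 : ℚ) ^ m - m - 1 := by
    intro m
    have h : m < 2 ^ m := m.lt_two_pow_self
    rw [Nat.cast_sub (by omega), Nat.cast_sub (by omega)]
    push_cast
    ring
  simp only [e]

/-- **`Table.F t g l = FsumAdd (6 − t) g l`** on a profile satisfying the realisability bounds. -/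
theorem F_eq_FsumAdd {t g : ℕ} (ht : t = 1 ∨ t = 2 ∨ t = 3) {l : List ℕ} (hm : ∀ m ∈ l, 3 ≤ m ∧ m ≤ g)
    (hN : ∀ s, 3 ≤ s → (Multiset.map (fun m => m.choose s) (l : Multiset ℕ)).sum ≤ g.choose s)
    (h4 : lps g (l : Multiset ℕ) 4 ≤ Ns g (l : Multiset ℕ) 4)
    (h5 : lps g (l : Multiset ℕ) 5 ≤ Ns g (l : Multiset ℕ) 5)
    (h6 : ∀ s, 6 ≤ s → (Multiset.map (fun m => m.choose (s - 2) * (g - m).choose 2) (l : Multiset ℕ)).sum +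
      lps g (l : Multiset ℕ) s ≤ Ns g (l : Multiset ℕ) s) :
    Table.F t g l = FsumAdd (6 - t) g (l : Multiset ℕ) := by
  unfold Table.F FsumAdd
  rw [sumIcc_eq, Tcnt_cast (hN 3 (by norm_num)), N4c_cast, N4g_cast hm (hN 4 (by norm_num)) h4,
    vTriple_eq ht, vGen4_eq ht, vCol4_eq ht]
  have hsum : ∀ s ∈ Finset.Icc 5 g,
      Table.lps g l s * Table.vLp t s + Table.ds g l s * Table.vNon t s + Table.rests g l s * Table.vRest t s =
      ((lps g (l : Multiset ℕ) s : ℕ) : ℚ) * vlp (6 - t) s + ((dsAdd g (l : Multiset ℕ) s : ℕ) : ℚ) * vd (6 - t) s +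
        ((restsAdd g (l : Multiset ℕ) s : ℕ) : ℚ) * vrest (6 - t) s := by
    intro s hs
    have hs5 : 5 ≤ s := (Finset.mem_Icc.1 hs).1
    rw [lps_cast, dsAdd_cast hs5 h5 (hN 5 (by norm_num)), restsAdd_cast hs5 h5 hN h6,
      vLp_eq ht (by omega), vNon_eq ht, vRest_eq ht]
  rw [Finset.sum_congr rfl hsum]
  rfl

end SixThree

end PercRepro
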